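import Literature.AlgebraicGeometry.Frobenioids.FrobenioidRealification
import Literature.AlgebraicGeometry.Frobenioids.BaseCategoryTheoreticity
import Literature.AlgebraicGeometry.Frobenioids.BaseSectionsOfObjectsCor57NonVacuity
import Literature.AlgebraicGeometry.Frobenioids.ArithmeticFrobenioidFrobeniusCompact
import Literature.AlgebraicGeometry.Frobenioids.RealificationDataCanonical
import Literature.AlgebraicGeometry.Frobenioids.ElementaryPreFrobenioid
import Mathlib.NumberTheory.Cyclotomic.PrimitiveRoots
import Mathlib.CategoryTheory.Category.Preorder
import Mathlib.Algebra.Group.PUnit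
import HarnessLib

/-!
# Frobenioids I, Corollary 5.4 (Category-theoreticity of the Realification): the typed hypothesis
# `PreservesBaseIsoIfGroupLike` and the typed schema `Cor54` — exact universal closures REFUTED,
# junction and instance forms

Mochizuki, *The geometry of Frobenioids I: the general theory*, Kyushu J. Math. **62** (2008)
293–400, §5, Corollary 5.4, kurims text pp. 103–104 [cite: MochizukiFrdI2008, Cor. 5.4 p.103].

PROOF-ONLY companion of `FrobenioidRealification.lean` (abc-iut cell, F fact-proving wave, seat
abc-iut-f-040; FACT-LIST rows F-1094 `PreFrobenioid.PreservesBaseIsoIfGroupLike` and F-1093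
`PreFrobenioid.Cor54`, both declared there by abc-iut-L1-t5 as `Prop`-valued statements over interface
PARAMETERS, never asserted; nothing is edited or restated here).

* **F-1094** is the printed HYPOTHESIS of Cor. 5.4 ("if `C₁`, `C₂` are of group-like type, then we also
  assume that both `Ψ` and some quasi-inverse to `Ψ` preserve base-isomorphisms", p. 103), a predicate on
  `(F₁, F₂, Ψ)` — not a claim. Recorded here: (a) it IS abc-iut-L1-t3's hypothesis (b) `HypB` of
  Thm. 3.4/Cor. 4.11 read through the operations adapter `PreFrobenioidData.ofFunctor`
  (`preservesBaseIsoIfGroupLike_iff_hypB`, definitional junction); (b) it holds whenever its antecedent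
  is idle — e.g. at THE arithmetic Frobenioids `C_{K/F}` of Ex. 6.3, which are not of group-like type
  (`preservesBaseIsoIfGroupLike_arith`) — and for `Ψ = 1`; (c) its UNIVERSAL CLOSURE IS FALSE
  (`not_forall_preservesBaseIsoIfGroupLike`: over the two-object base `0 → 1` with the zero monoid, the
  identity equivalence between the zero section and a constant structure functor does not preserve
  base-isomorphisms) — so the row is a schema, bindable only at named instances (R5).
* **F-1093** `Cor54 F₁ F₂ Rp₁ Rp₂ R₁ R₂ ι₁ ι₂ Ψ` quantifies the printed conclusion ("there exists a
  1-unique functor `Ψ^rlf : C₁^rlf → C₂^rlf` that fits into a 1-commutative diagram … rigid") over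
  ARBITRARY functors `ι_i : C_i → C_i^rlf` standing for "the natural functors of Proposition 5.3". Its
  UNIVERSAL CLOSURE IS FALSE (`not_forall_cor54`): at THE arithmetic Frobenioid `C_{K/ℚ}`,
  `K = ℚ(ζ₃)` (all nine hypotheses discharged BY NAME: `arithFrobenioid_isFrobenioid`,
  `arith_objectwise_isPerfFactorial`, `arith_ofFunctor_isDivSlim`,
  `arithFrobenioid_isOfRationallyStandardType_rsParams`; Ψ = 1) with `ι₁ = ι₂` a CONSTANT functor, the
  1-uniqueness clause forces the equivalence `Ψ^rlf` to be isomorphic to a constant functor, whence all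
  objects of `C^rlf` would be isomorphic (`nonempty_iso_of_oneUnique_const`, pure category theory) —
  but the objects over `Spec ℚ` and `Spec K` are not (`finSubextCat_bot_not_iso_top`: degree `2 ≠ 1`).
  The instance form AT THE DATA (`ι_i :=` THE functors of Prop. 5.3) is the cell's sub-DAG
  `plan/L1/SUBDAG-FrdI-Prop53-Cor54.md` (`Cor54Sub.*`: `rlfTransport_holds`, `rigid_of`,
  `oneUniqueData_holds`, `Cor54SubStrongUniqueReduction`, …) and is NOT re-proved here.

HONEST LABEL. A refuted universal closure says only that the typed schema is not a closed fact; it says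
nothing about the printed Corollary at its data. no side taken on [IUTchIII] Cor. 3.12; a FACT row is an
assumption label; typed ≠ proved; proved = OUR kernel check. No definition, no named fact, no `sorry`.
-/

noncomputable section

namespace Literature.AlgebraicGeometry.Frobenioids

open CategoryTheory Opposite

universe w v v' u u'

namespace PreFrobenioid

/-! ### F-1094: junction with `HypB`, idle-antecedent instances -/

section Junction

variable {D₁ : Type u} [Category.{v} D₁] {Φ₁ : D₁ᵒᵖ ⥤ CommMonCat.{w}}
  {C₁ : Type u'} [Category.{v'} C₁] (F₁ : C₁ ⥤ ElemFrobenioid Φ₁)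
  {D₂ : Type u} [Category.{v} D₂] {Φ₂ : D₂ᵒᵖ ⥤ CommMonCat.{w}}
  {C₂ : Type u'} [Category.{v'} C₂] (F₂ : C₂ ⥤ ElemFrobenioid Φ₂) (Ψ : C₁ ≌ C₂)

/-- **Junction (F-1094)**: abc-iut-L1-t5's `PreservesBaseIsoIfGroupLike F₁ F₂ Ψ` IS abc-iut-L1-t3's
hypothesis (b) `HypB` of Thm. 3.4 (iii)–(v) / Cor. 4.11 / Cor. 4.12 for the operations
`PreFrobenioidData.ofFunctor Φ_i F_i` (definitional, clause by clause).
[cite: MochizukiFrdI2008, Cor. 5.4 p.103] -/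
theorem preservesBaseIsoIfGroupLike_iff_hypB :
    PreservesBaseIsoIfGroupLike F₁ F₂ Ψ ↔
      (PreFrobenioidData.ofFunctor Φ₁ F₁).HypB (PreFrobenioidData.ofFunctor Φ₂ F₂) Ψ :=
  ⟨fun h g₁ g₂ => h (fun A => g₁.obj A) (fun A => g₂.obj A), fun h g₁ g₂ => h ⟨g₁⟩ ⟨g₂⟩⟩

/-- F-1094 holds whenever `C₁` is NOT of group-like type (its antecedent is idle).
[cite: MochizukiFrdI2008, Cor. 5.4 p.103] -/
theorem preservesBaseIsoIfGroupLike_of_not_isOfType_left (h : ¬ IsOfType (IsGroupLikeObj F₁)) :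
    PreservesBaseIsoIfGroupLike F₁ F₂ Ψ := fun h₁ _ => absurd h₁ h

/-- F-1094 holds whenever `C₂` is NOT of group-like type (its antecedent is idle).
[cite: MochizukiFrdI2008, Cor. 5.4 p.103] -/
theorem preservesBaseIsoIfGroupLike_of_not_isOfType_right (h : ¬ IsOfType (IsGroupLikeObj F₂)) :
    PreservesBaseIsoIfGroupLike F₁ F₂ Ψ := fun _ h₂ => absurd h₂ h

/-- F-1094 holds for the identity equivalence `Ψ = 1_C` (same structure functor on both sides).
[cite: MochizukiFrdI2008, Cor. 5.4 p.103] -/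
theorem preservesBaseIsoIfGroupLike_refl :
    PreservesBaseIsoIfGroupLike F₁ F₁ (CategoryTheory.Equivalence.refl (C := C₁)) :=
  fun _ _ => ⟨fun _ _ _ h => h, fun _ _ _ h => h⟩

end Junction

/-! ### F-1094: the universal closure is false -/

/-- **F-1094 as a SCHEMA: the universal closure of `PreservesBaseIsoIfGroupLike` is FALSE.** Over the
two-object base `D = {0 → 1}` (the ordinal `2`) with the zero monoid `Φ = 0` (so every object is
group-like), take `C₁ = C₂ = D`, `F₂ = ` the zero section `D → F_Φ`, `F₁ = ` the constant functor at the
object `0` of `F_Φ`, `Ψ = 1_D`: the arrow `0 → 1` is a base-isomorphism for `F₁` (its base is `id_0`) but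
not for `F₂` (its base is `0 → 1`, not invertible). [cite: MochizukiFrdI2008, Cor. 5.4 p.103] -/
theorem not_forall_preservesBaseIsoIfGroupLike :
    ¬ ∀ (D₁ : Type) [Category.{0} D₁] (Φ₁ : D₁ᵒᵖ ⥤ CommMonCat.{0}) (C₁ : Type) [Category.{0} C₁]
        (F₁ : C₁ ⥤ ElemFrobenioid Φ₁)
        (D₂ : Type) [Category.{0} D₂] (Φ₂ : D₂ᵒᵖ ⥤ CommMonCat.{0}) (C₂ : Type) [Category.{0} C₂]
        (F₂ : C₂ ⥤ ElemFrobenioid Φ₂) (Ψ : C₁ ≌ C₂), PreservesBaseIsoIfGroupLike F₁ F₂ Ψ := by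
  intro h
  let Φ₀ : (Fin 2)ᵒᵖ ⥤ CommMonCat.{0} := (Functor.const _).obj (CommMonCat.of PUnit)
  let F₂ : Fin 2 ⥤ ElemFrobenioid Φ₀ := ElemFrobenioid.zeroSection Φ₀
  let F₁ : Fin 2 ⥤ ElemFrobenioid Φ₀ := (Functor.const (Fin 2)).obj (ElemFrobenioid.of Φ₀ 0)
  have hg₁ : IsOfType (IsGroupLikeObj F₁) := fun _ _ => rfl
  have hg₂ : IsOfType (IsGroupLikeObj F₂) := fun _ _ => rfl
  let f : (0 : Fin 2) ⟶ 1 := homOfLE (Fin.zero_le _)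
  have hf : IsBaseIso F₁ f := (inferInstance : IsIso (𝟙 (0 : Fin 2)))
  haveI : IsIso f := ((h _ Φ₀ _ F₁ _ Φ₀ _ F₂ (CategoryTheory.Equivalence.refl (C := Fin 2))) hg₁ hg₂).1 f hf
  exact absurd (asIso f).to_eq (by decide)

/-! ### F-1094 at THE arithmetic Frobenioids (idle antecedent) -/

section Arith

variable (F₁ : Type) [Field F₁] [NumberField F₁] (K₁ : Type) [Field K₁] [Algebra F₁ K₁]
variable (F₂ : Type) [Field F₂] [NumberField F₂] (K₂ : Type) [Field K₂] [Algebra F₂ K₂]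

/-- **F-1094 at THE arithmetic Frobenioids `C_{K/F}` of [FrdI] Ex. 6.3 / Thm. 6.4**: for every
equivalence `Ψ : C_{K₁/F₁} ⥲ C_{K₂/F₂}` the hypothesis holds, because `C_{K₁/F₁}` is NOT of group-like
type (`Φ ≠ 0`, abc-iut-L6-t10's `not_isOfGroupLikeType_arith`) — its antecedent is idle there.
[cite: MochizukiFrdI2008, Cor. 5.4 p.103] -/
theorem preservesBaseIsoIfGroupLike_arith (Ψ : arithFrobenioid F₁ K₁ ≌ arithFrobenioid F₂ K₂) :
    PreservesBaseIsoIfGroupLike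
      (ModelFrobenioid.toElem (arithDivisorFunctor F₁ K₁) (unitsFunctor F₁ K₁) (divNatTrans F₁ K₁))
      (ModelFrobenioid.toElem (arithDivisorFunctor F₂ K₂) (unitsFunctor F₂ K₂) (divNatTrans F₂ K₂)) Ψ :=
  preservesBaseIsoIfGroupLike_of_not_isOfType_left _ _ Ψ (arith_not_isOfType_isGroupLikeObj' F₁ K₁)

end Arith

/-! ### F-1093: the universal closure of the typed `Cor54` is false -/

/-- Category-theoretic core of the refutation: if an equivalence `G : E ⥤ E` with `G X₀ ≅ X₀` is
isomorphic to EVERY functor `G'` fitting into the square `const_{X₀} ⋙ G' ≅ 1 ⋙ const_{X₀}` (the typed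
1-uniqueness clause of `Cor54` read at constant `ι₁ = ι₂ = const_{X₀}`), then — testing with
`G' := const_{G X₀}` — every object `X₁` of `E` is isomorphic to `X₀`.
[cite: MochizukiFrdI2008, Cor. 5.4 p.103] -/
theorem nonempty_iso_of_oneUnique_const {C : Type u} [Category.{v} C] {E : Type u'} [Category.{v'} E]
    (X₀ X₁ : E) (G : E ⥤ E) [G.IsEquivalence] (e₀ : G.obj X₀ ≅ X₀)
    (huniq : ∀ G' : E ⥤ E,
      Nonempty ((Functor.const C).obj X₀ ⋙ G' ≅
        (CategoryTheory.Equivalence.refl (C := C)).functor ⋙ (Functor.const C).obj X₀) →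
        Nonempty (G' ≅ G)) :
    Nonempty (X₀ ≅ X₁) := by
  obtain ⟨τ⟩ := huniq ((Functor.const E).obj (G.obj X₀))
    ⟨NatIso.ofComponents (fun _ => e₀) (fun f => by
      show 𝟙 (G.obj X₀) ≫ e₀.hom = e₀.hom ≫ 𝟙 X₀
      rw [Category.id_comp, Category.comp_id])⟩
  exact ⟨G.preimageIso ((τ.app X₀).symm ≪≫ τ.app X₁)⟩

/-- In the base `D = B(Gal(K/ℚ))⁰` of `C_{K/ℚ}`, `K = ℚ(ζ₃)`, the objects `Spec ℚ` and `Spec K` are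
not isomorphic (an isomorphism would give a `ℚ`-algebra map `K → ℚ`, but `[K : ℚ] = 2`).
[cite: MochizukiFrdI2008, Ex. 6.3 p.113] -/
theorem finSubextCat_bot_not_iso_top
    (j : (⟨⊥⟩ : FinSubextCat ℚ (CyclotomicField 3 ℚ)) ≅ ⟨⊤⟩) : False := by
  haveI : IsCyclotomicExtension {3} ℚ (CyclotomicField 3 ℚ) :=
    CyclotomicField.isCyclotomicExtension 3 ℚ
  have hinj : Function.Injective j.hom.toAlgHom.toLinearMap := fun a b hab =>
    j.hom.toAlgHom.toRingHom.injective hab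
  have hle := LinearMap.finrank_le_finrank_of_injective hinj
  rw [IntermediateField.finrank_bot, IntermediateField.finrank_top',
    IsCyclotomicExtension.finrank (n := 3) (CyclotomicField 3 ℚ)
      (Polynomial.cyclotomic.irreducible_rat (by norm_num))] at hle
  exact absurd hle (by decide)

/-- **F-1093 as a SCHEMA: the universal closure of `Cor54` (over the functor parameters `ι₁, ι₂`) is
FALSE.** At THE arithmetic Frobenioid `C = C_{K/ℚ}`, `K = ℚ(ζ₃)` (a Frobenioid of rationally standard
type over the Div-slim base `B(Gal(K/ℚ))⁰` with perf-factorial `Φ` — all discharged in the tree), with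
`Ψ = 1_C`, THE realification data, and `ι₁ = ι₂ := ` the constant functor at the object `(Spec ℚ, 0)` of
`C^rlf`: the square condition is then also satisfied by the constant functor at `Ψ^rlf(Spec ℚ, 0)`, so
the typed 1-uniqueness clause makes the equivalence `Ψ^rlf` isomorphic to a constant functor; an
equivalence isomorphic to a constant functor identifies all objects up to isomorphism, yet
`(Spec ℚ, 0) ≇ (Spec K, 0)` in `C^rlf` (their bases `Spec ℚ ≇ Spec K` in `D`).
[cite: MochizukiFrdI2008, Cor. 5.4 p.103] -/
theorem not_forall_cor54 :
    ¬ ∀ (D₁ : Type) [Category.{0} D₁] (Φ₁ : D₁ᵒᵖ ⥤ CommMonCat.{0}) (C₁ : Type) [Category.{0} C₁]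
        (F₁ : C₁ ⥤ ElemFrobenioid Φ₁)
        (D₂ : Type) [Category.{0} D₂] (Φ₂ : D₂ᵒᵖ ⥤ CommMonCat.{0}) (C₂ : Type) [Category.{0} C₂]
        (F₂ : C₂ ⥤ ElemFrobenioid Φ₂)
        (Rp₁ : PreFrobenioidData.RSParams.{0, 0, 0, 0, 0, 0} (PreFrobenioidData.ofFunctor Φ₁ F₁))
        (Rp₂ : PreFrobenioidData.RSParams.{0, 0, 0, 0, 0, 0} (PreFrobenioidData.ofFunctor Φ₂ F₂))
        (R₁ : RealificationData Φ₁) (R₂ : RealificationData Φ₂)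
        (ι₁ : C₁ ⥤ realification F₁ R₁) (ι₂ : C₂ ⥤ realification F₂ R₂) (Ψ : C₁ ≌ C₂),
        Cor54 F₁ F₂ Rp₁ Rp₂ R₁ R₂ ι₁ ι₂ Ψ := by
  intro h
  -- THE arithmetic Frobenioid `C_{K/ℚ}`, `K = ℚ(ζ₃)`
  haveI : IsCyclotomicExtension {3} ℚ (CyclotomicField 3 ℚ) :=
    CyclotomicField.isCyclotomicExtension 3 ℚ
  haveI : IsGalois ℚ (CyclotomicField 3 ℚ) := IsCyclotomicExtension.isGalois {3} ℚ (CyclotomicField 3 ℚ)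
  have hF := arithFrobenioid_isFrobenioid ℚ (CyclotomicField 3 ℚ)
  have hPF : IsPerfFactorialOn (arithDivisorFunctor ℚ (CyclotomicField 3 ℚ)) :=
    arith_objectwise_isPerfFactorial ℚ (CyclotomicField 3 ℚ)
  -- THE realification data, two objects of `C^rlf` over `Spec ℚ` and `Spec K`, an object of `C`
  let R : RealificationData (arithDivisorFunctor ℚ (CyclotomicField 3 ℚ)) :=
    RealificationData.canonical (arithDivisorFunctor ℚ (CyclotomicField 3 ℚ)) fun X => hPF X.unop
  let X₀ : realification
      (ModelFrobenioid.toElem (arithDivisorFunctor ℚ (CyclotomicField 3 ℚ))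
        (unitsFunctor ℚ (CyclotomicField 3 ℚ)) (divNatTrans ℚ (CyclotomicField 3 ℚ))) R := ⟨⟨⊥⟩, 1⟩
  let X₁ : realification
      (ModelFrobenioid.toElem (arithDivisorFunctor ℚ (CyclotomicField 3 ℚ))
        (unitsFunctor ℚ (CyclotomicField 3 ℚ)) (divNatTrans ℚ (CyclotomicField 3 ℚ))) R := ⟨⟨⊤⟩, 1⟩
  let c₀ : arithFrobenioid ℚ (CyclotomicField 3 ℚ) := ⟨⟨⊥⟩, 1⟩
  -- the typed Cor54 at these data, `ι₁ = ι₂ = const_{X₀}`, `Ψ = 1`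
  obtain ⟨Ψrlf, ⟨e⟩, hEq, huniq, -, -⟩ :=
    h _ _ _ _ _ _ _ _ (rsParams hF fun a 𝔭 => PrimarySupp a 𝔭) (rsParams hF fun a 𝔭 => PrimarySupp a 𝔭)
      R R ((Functor.const _).obj X₀) ((Functor.const _).obj X₀)
      (CategoryTheory.Equivalence.refl (C := arithFrobenioid ℚ (CyclotomicField 3 ℚ))) hF hF hPF hPF
      (arith_ofFunctor_isDivSlim ℚ (CyclotomicField 3 ℚ)) (arith_ofFunctor_isDivSlim ℚ (CyclotomicField 3 ℚ))
      (arithFrobenioid_isOfRationallyStandardType_rsParams ℚ (CyclotomicField 3 ℚ))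
      (arithFrobenioid_isOfRationallyStandardType_rsParams ℚ (CyclotomicField 3 ℚ))
      (preservesBaseIsoIfGroupLike_refl _)
  haveI := hEq
  -- all objects of `C^rlf` would be isomorphic to `X₀`; project `X₀ ≅ X₁` to the base
  obtain ⟨i⟩ := nonempty_iso_of_oneUnique_const X₀ X₁ Ψrlf (e.app c₀) huniq
  exact finSubextCat_bot_not_iso_top ((ModelFrobenioid.baseFunctor _ _ _).mapIso i)

end PreFrobenioid

end Literature.AlgebraicGeometry.Frobenioids

end
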